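/-
Copyright: public-audit package `pub-balaban` (b2b-balaban), seat pv28-g13. Released under Apache 2.0 like Mathlib.
-/
import Literature.MathematicalPhysics.QuantumFieldTheory.Balaban1983to89.T4WilsonDatumBounds

/-!
# T4 — caveat (ALIGN), items (ARITH) + (LOC): the NUMERIC modulus floor of the Wilson small-field corollary and the
# Lipschitz hypothesis LOCALISED to the staple bonds

* Value = kernel certificate (real arithmetic + one application of the parent plug BY NAME); NOT summit progress; NOT
  continuum; NOT Clay.  0 [cite], 0 [model]: everything here is [folklore]; NO printed sentence is asserted and nothing
  internally minted is cited (ABSOLUTE RULE).  Cell row T4-O3.E-iii-b-G7 (BL-window), lineage pv28, record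
  `t4/T4-EST-O3Eiiib-G7.md` §2decies–§2duodecies; this leaf types the items (ARITH) and (LOC) of GAPS G-pv28g13-3.
* WHAT IT ADDS to `T4WilsonDatumBounds` (whose corollary `mem_respDom_of_wilson_smallField` still carried a modulus
  binder `hmu : mu ≤ gnoMu (β·w·2(d−1)·(1−ε)) (β·w·2(d−1)·√(2ε)) ρ`, a positivity binder `hlam : 0 < gnoKappa S' + mu`
  and a GLOBAL link-closeness hypothesis `hδ : ∀ b', ‖su2Quat (u b') − su2Quat (u₀ b')‖ ≤ δ`):
  (1) THE NUMERIC MODULUS FLOOR `gnoMu_smallField_ge : 7/25·M ≤ gnoMu (M·(1−ε)) (M·√(2ε)) ρ` for `0 ≤ M`,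
      `ε ≤ 1/8`, `0 ≤ ρ ≤ 1/4` (`√(2ε) ≤ 1/2`, `√(1+ρ²) ≤ 1 + ρ²/2 ≤ 33/32`, `(1+ρ²)² ≤ 289/256`, so the aligned
      term is `≥ 6272/9537·M` and the transverse penalty `≤ 3M/8`);
  (2) THE WINDOW FLOOR `gnoKappa_window_ge : 960/289 ≤ gnoKappa S` for `3S² ≤ 1/16` (and `gnoKappa_pos` for
      `3S² < 1`), hence the convexity modulus `λ = gnoKappa S' + 7/25·M ≥ 960/289 + 7/25·M > 3.3` and the slope bound
      `bH/√λ ≤ bH/√(960/289 + 7/25·M)` (`slope_le_of_window`);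
  (3) (LOC) `IsStaple b b'` (b' ≠ b shares a plaquette with b) and the Lipschitz bounds of `T4WilsonDatumBounds`
      under δ-closeness on the STAPLE bonds of `b` only: `norm_plaqDatum_sub_le_of_staple` (3δ),
      `norm_wilsonDatum_sub_le_of_staple` (|c·w|·N_b·3δ) — the six letter inequalities of `T4WilsonLinkAffine`
      supply `b' ≠ b`;
  (4) THE NUMERIC COROLLARY `mem_respDom_of_wilson_smallField_num`: the parent plug
      `T4GnomonicWilsonHessian.mem_respDom_of_gnoChart_linkAffine'` for `h = fun U => −β * wilsonAction w U` whose
      remaining scalar binders are `0 ≤ β`, `0 ≤ w`, `0 ≤ ε ≤ 1/8`, the plaquette conditions `reTr ≥ 1 − ε` through `b`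
      (at `u₀` and at `u with u(b) := u₀ b`), `0 ≤ δ` and δ-closeness on the staple bonds, `0 ≤ ρ ≤ 1/4`,
      `n·S'² ≤ ρ²`, and the budget `β·w·2(d−1)·3δ·(1+ρ+ρ²) ≤ bH·dev u`; the modulus in the conclusion is the EXPLICIT
      number `gnoKappa S' + 7/25·(β·w·2(d−1))` (`n = 3` is read off the chart equivalence, `card_fibre_eq`).

## Honest caveats

* (USE) unchanged: that Bałaban's small-field region supplies a plaquette small field of size `ε ≤ 1/8` through `b`
  on a δ-neighbourhood of the base field UNIFORMLY in the step `k`, and that the consumer's `dev u` dominates the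
  staple-link distance, is NOT proved here (consumer-side / EST; GAPS G-pv28g13-3).  The thresholds `1/8`, `1/4` and
  the constant `7/25` are a convenient choice, not optimal.  (N1) one-link fibres; (RANK) `SU(2)`; (INS) the
  measurability / integrability / insert binders are the plug's; (k ≥ 1) k = 0 Wilson exponent only.
-/

noncomputable section

open scoped Quaternion

namespace Literature.MathematicalPhysics.QuantumFieldTheory.Balaban1983to89.T4WilsonSmallFieldNumerics

open Literature.MathematicalPhysics.QuantumLattice (su2Quat norm_su2Quat)
open Literature.Probability.Distributions (coordGradient)
open Function (updateFinset)
open T4HaarSU2Translate (su2Quat_mul)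
open T4CubePoincare (cube)
open T4CubeChartGnomonic (SU2 gnoFibreChart windowDensity)
open T4CubeConvexExtension (gnoKappa)
open T4GnomonicWilsonHessian (gnoMu gnoMu_mono_left mem_respDom_of_gnoChart_linkAffine')
open T4WilsonLinkAffine
open T4WilsonDatumBounds

variable {P : Params} {j : ℕ}

/-! ## §1  Square-root bookkeeping -/

/-- `√(2ε) ≤ 1/2` for `ε ≤ 1/8`. [folklore] -/
theorem sqrt_two_mul_le_half {ε : ℝ} (hε : ε ≤ 1 / 8) : Real.sqrt (2 * ε) ≤ 1 / 2 := by
  have h : 2 * ε ≤ (1 / 2) ^ 2 := by nlinarith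
  calc Real.sqrt (2 * ε) ≤ Real.sqrt ((1 / 2) ^ 2) := Real.sqrt_le_sqrt h
    _ = 1 / 2 := Real.sqrt_sq (by norm_num)

/-- `√(1 + ρ²) ≤ 1 + ρ²/2`. [folklore] -/
theorem sqrt_one_add_sq_le (ρ : ℝ) : Real.sqrt (1 + ρ ^ 2) ≤ 1 + ρ ^ 2 / 2 := by
  have h0 : 0 ≤ 1 + ρ ^ 2 / 2 := by positivity
  calc Real.sqrt (1 + ρ ^ 2) ≤ Real.sqrt ((1 + ρ ^ 2 / 2) ^ 2) :=
        Real.sqrt_le_sqrt (by nlinarith [sq_nonneg (ρ ^ 2)])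
    _ = 1 + ρ ^ 2 / 2 := Real.sqrt_sq h0

/-- `1 ≤ √(1 + ρ²)`. [folklore] -/
theorem one_le_sqrt_one_add_sq (ρ : ℝ) : 1 ≤ Real.sqrt (1 + ρ ^ 2) :=
  calc (1 : ℝ) = Real.sqrt 1 := Real.sqrt_one.symm
    _ ≤ Real.sqrt (1 + ρ ^ 2) := Real.sqrt_le_sqrt (by nlinarith [sq_nonneg ρ])

/-! ## §2  The numeric modulus floor -/

/-- **THE NUMERIC MODULUS FLOOR.**  For `0 ≤ M`, `ε ≤ 1/8`, `0 ≤ ρ ≤ 1/4` (for `ε < 0` Mathlib's `√(2ε) = 0` and the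
bound only improves; the meaningful range is `0 ≤ ε ≤ 1/8`):
`7/25 · M ≤ gnoMu (M·(1−ε)) (M·√(2ε)) ρ = M·(1−ε)(1−2ρ²)/((1+ρ²)²√(1+ρ²)) − 3·M·√(2ε)·ρ`.
(Aligned term `≥ (49/64)·(8192/9537)·M = 6272/9537·M`, penalty `≤ 3M/8`, and `6272/9537 − 3/8 ≥ 7/25`.) [folklore] -/
theorem gnoMu_smallField_ge {M ε ρ : ℝ} (hM : 0 ≤ M) (hε : ε ≤ 1 / 8) (hρ0 : 0 ≤ ρ) (hρ : ρ ≤ 1 / 4) :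
    7 / 25 * M ≤ gnoMu (M * (1 - ε)) (M * Real.sqrt (2 * ε)) ρ := by
  rw [T4GnomonicWilsonHessian.gnoMu]
  have hs1 : 1 ≤ Real.sqrt (1 + ρ ^ 2) := one_le_sqrt_one_add_sq ρ
  have hρsq : ρ ^ 2 ≤ 1 / 16 := by nlinarith
  have hs2 : Real.sqrt (1 + ρ ^ 2) ≤ 33 / 32 := (sqrt_one_add_sq_le ρ).trans (by linarith)
  have hD : (1 + ρ ^ 2) ^ 2 * Real.sqrt (1 + ρ ^ 2) ≤ 9537 / 8192 := by
    have h1 : (1 + ρ ^ 2) ^ 2 ≤ 289 / 256 := by nlinarith [sq_nonneg ρ]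
    calc (1 + ρ ^ 2) ^ 2 * Real.sqrt (1 + ρ ^ 2) ≤ 289 / 256 * (33 / 32) :=
          mul_le_mul h1 hs2 (by positivity) (by norm_num)
      _ = 9537 / 8192 := by norm_num
  have hDpos : 0 < (1 + ρ ^ 2) ^ 2 * Real.sqrt (1 + ρ ^ 2) := mul_pos (by positivity) (by linarith)
  have hN : 49 / 64 ≤ (1 - ε) * (1 - 2 * ρ ^ 2) := by nlinarith
  have hT1 : M * (6272 / 9537) ≤ M * (1 - ε) * (1 - 2 * ρ ^ 2) / ((1 + ρ ^ 2) ^ 2 * Real.sqrt (1 + ρ ^ 2)) := by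
    rw [le_div_iff₀ hDpos]
    calc M * (6272 / 9537) * ((1 + ρ ^ 2) ^ 2 * Real.sqrt (1 + ρ ^ 2)) ≤ M * (6272 / 9537) * (9537 / 8192) :=
          mul_le_mul_of_nonneg_left hD (by positivity)
      _ = M * (49 / 64) := by ring
      _ ≤ M * ((1 - ε) * (1 - 2 * ρ ^ 2)) := mul_le_mul_of_nonneg_left hN hM
      _ = M * (1 - ε) * (1 - 2 * ρ ^ 2) := by ring
  have ht : Real.sqrt (2 * ε) ≤ 1 / 2 := sqrt_two_mul_le_half hε
  have ht0 : 0 ≤ Real.sqrt (2 * ε) := Real.sqrt_nonneg _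
  have hT2 : 3 * (M * Real.sqrt (2 * ε)) * ρ ≤ 3 * M * (1 / 8) := by
    have h : Real.sqrt (2 * ε) * ρ ≤ 1 / 2 * (1 / 4) := mul_le_mul ht hρ hρ0 (by norm_num)
    have h' : M * (Real.sqrt (2 * ε) * ρ) ≤ M * (1 / 2 * (1 / 4)) := mul_le_mul_of_nonneg_left h hM
    nlinarith [h']
  have hnum : 0 ≤ M * (6272 / 9537 - 3 / 8 - 7 / 25) := mul_nonneg hM (by norm_num)
  linarith [hT1, hT2, hnum]

/-- The positivity region: if moreover `M` is positive the floor is positive. [folklore] -/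
theorem gnoMu_smallField_pos {M ε ρ : ℝ} (hM : 0 < M) (hε : ε ≤ 1 / 8) (hρ0 : 0 ≤ ρ) (hρ : ρ ≤ 1 / 4) :
    0 < gnoMu (M * (1 - ε)) (M * Real.sqrt (2 * ε)) ρ :=
  lt_of_lt_of_le (by positivity) (gnoMu_smallField_ge hM.le hε hρ0 hρ)

/-! ## §3  The window floor of `gnoKappa` -/

/-- `gnoKappa S = 4(1 − 3S²)/(1 + 3S²)² > 0` for `3S² < 1`. [folklore] -/
theorem gnoKappa_pos {S : ℝ} (h : 3 * S ^ 2 < 1) : 0 < gnoKappa S := by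
  rw [T4CubeConvexExtension.gnoKappa_eq]
  exact div_pos (by linarith) (by positivity)

/-- **THE WINDOW FLOOR** `960/289 ≤ gnoKappa S` for `3S² ≤ 1/16` (the one-link window `n·S'² ≤ ρ² ≤ 1/16`, `n = 3`).
[folklore] -/
theorem gnoKappa_window_ge {S : ℝ} (h : 3 * S ^ 2 ≤ 1 / 16) : 960 / 289 ≤ gnoKappa S := by
  rw [T4CubeConvexExtension.gnoKappa_eq, le_div_iff₀ (by positivity)]
  have hy : 0 ≤ 3 * S ^ 2 := by positivity
  nlinarith [mul_nonneg hy (sub_nonneg.2 h), sub_nonneg.2 h]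

/-- The slope of the response bound only improves when the modulus is replaced by its floor:
`bH/√(gnoKappa S' + 7/25·M) ≤ bH/√(960/289 + 7/25·M)`. [folklore] -/
theorem slope_le_of_window {S' M bH : ℝ} (h3S : 3 * S' ^ 2 ≤ 1 / 16) (hM : 0 ≤ M) (hbH : 0 ≤ bH) :
    bH / Real.sqrt (gnoKappa S' + 7 / 25 * M) ≤ bH / Real.sqrt (960 / 289 + 7 / 25 * M) := by
  have hk := gnoKappa_window_ge h3S
  have hpos : 0 < Real.sqrt (960 / 289 + 7 / 25 * M) := Real.sqrt_pos.2 (by positivity)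
  exact div_le_div_of_nonneg_left hbH hpos (Real.sqrt_le_sqrt (by linarith))

/-! ## §4  (LOC) The Lipschitz hypothesis localised to the staple bonds -/

section Loc

/-- `b'` is a STAPLE bond of `b`: a bond different from `b` sharing a plaquette with it (there are at most
`3·2(d−1)` of them). [folklore] -/
def IsStaple (b b' : PBond P j) : Prop := b' ≠ b ∧ ∃ p : Plaq P j, IsLetter b p ∧ IsLetter b' p

/-- A global δ-closeness is in particular a staple one. [folklore] -/
theorem staple_of_global {u u' : GaugeField P j SU2} {δ : ℝ}
    (hδ : ∀ b' : PBond P j, ‖su2Quat (u b') - su2Quat (u' b')‖ ≤ δ) (b : PBond P j) :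
    ∀ b', IsStaple b b' → ‖su2Quat (u b') - su2Quat (u' b')‖ ≤ δ :=
  fun b' _ => hδ b'

variable [DecidableEq (PBond P j)]

/-- **(LOC)** `‖plaqDatum u b p − plaqDatum u' b p‖ ≤ 3δ` under δ-closeness of the link quaternions on the STAPLE
bonds of `b` only. [folklore] -/
theorem norm_plaqDatum_sub_le_of_staple {u u' : GaugeField P j SU2} {b : PBond P j} {δ : ℝ} (hδ0 : 0 ≤ δ)
    (hδ : ∀ b', IsStaple b b' → ‖su2Quat (u b') - su2Quat (u' b')‖ ≤ δ) (p : Plaq P j) :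
    ‖plaqDatum u b p - plaqDatum u' b p‖ ≤ 3 * δ := by
  have n1 : ∀ V : SU2, ‖su2Quat V‖ = 1 := norm_su2Quat
  have L1 : IsLetter (bond₁ p) p := Or.inl rfl
  have L2 : IsLetter (bond₂ p) p := Or.inr (Or.inl rfl)
  have L3 : IsLetter (bond₃ p) p := Or.inr (Or.inr (Or.inl rfl))
  have L4 : IsLetter (bond₄ p) p := Or.inr (Or.inr (Or.inr rfl))
  unfold plaqDatum
  split_ifs with h1 h2 h3 h4
  · subst h1
    have d2 := hδ (bond₂ p) ⟨(bond₁_ne_bond₂ p).symm, p, L1, L2⟩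
    have d3 := hδ (bond₃ p) ⟨(bond₁_ne_bond₃ p).symm, p, L1, L3⟩
    have d4 := hδ (bond₄ p) ⟨(bond₁_ne_bond₄ p).symm, p, L1, L4⟩
    rw [su2Quat_mul, su2Quat_mul, su2Quat_mul, su2Quat_mul]
    refine (norm_mul₃_sub_le_of_norm_eq_one (n1 _) (n1 _) (n1 _) (n1 _)).trans ?_
    rw [norm_su2Quat_inv_sub, norm_su2Quat_inv_sub]
    linarith
  · subst h2
    have d1 := hδ (bond₁ p) ⟨bond₁_ne_bond₂ p, p, L2, L1⟩
    have d3 := hδ (bond₃ p) ⟨(bond₂_ne_bond₃ p).symm, p, L2, L3⟩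
    have d4 := hδ (bond₄ p) ⟨(bond₂_ne_bond₄ p).symm, p, L2, L4⟩
    rw [su2Quat_mul, su2Quat_mul]
    refine (norm_mul₃_sub_le_of_norm_eq_one (n1 _) (n1 _) (n1 _) (n1 _)).trans ?_
    rw [norm_su2Quat_inv_sub, norm_su2Quat_inv_sub]
    linarith
  · subst h3
    have d1 := hδ (bond₁ p) ⟨bond₁_ne_bond₃ p, p, L3, L1⟩
    have d2 := hδ (bond₂ p) ⟨bond₂_ne_bond₃ p, p, L3, L2⟩
    have d4 := hδ (bond₄ p) ⟨(bond₃_ne_bond₄ p).symm, p, L3, L4⟩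
    rw [← star_sub, Quaternion.norm_star, su2Quat_mul, su2Quat_mul, ← mul_assoc, ← mul_assoc]
    refine (norm_mul₃_sub_le_of_norm_eq_one (n1 _) (n1 _) (n1 _) (n1 _)).trans ?_
    rw [norm_su2Quat_inv_sub]
    linarith
  · subst h4
    have d1 := hδ (bond₁ p) ⟨bond₁_ne_bond₄ p, p, L4, L1⟩
    have d2 := hδ (bond₂ p) ⟨bond₂_ne_bond₄ p, p, L4, L2⟩
    have d3 := hδ (bond₃ p) ⟨bond₃_ne_bond₄ p, p, L4, L3⟩
    rw [← star_sub, Quaternion.norm_star, su2Quat_mul, su2Quat_mul, su2Quat_mul, su2Quat_mul]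
    refine (norm_mul₃_sub_le_of_norm_eq_one (n1 _) (n1 _) (n1 _) (n1 _)).trans ?_
    rw [norm_su2Quat_inv_sub]
    linarith
  · rw [sub_zero, norm_zero]
    linarith

/-- **(LOC)** `‖wilsonDatum c w u b − wilsonDatum c w u' b‖ ≤ |c·w|·N_b·3δ` under staple δ-closeness. [folklore] -/
theorem norm_wilsonDatum_sub_le_of_staple (c w : ℝ) {u u' : GaugeField P j SU2} {b : PBond P j} {δ : ℝ}
    (hδ0 : 0 ≤ δ) (hδ : ∀ b', IsStaple b b' → ‖su2Quat (u b') - su2Quat (u' b')‖ ≤ δ) :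
    ‖wilsonDatum c w u b - wilsonDatum c w u' b‖ ≤ |c * w| * (letterCount b : ℝ) * (3 * δ) := by
  unfold wilsonDatum
  rw [← Finset.sum_sub_distrib]
  refine (norm_sum_le _ _).trans ?_
  have h : ∀ p : Plaq P j, ‖(-(c * w)) • plaqDatum u b p - (-(c * w)) • plaqDatum u' b p‖ ≤
      |c * w| * (3 * δ) * (if IsLetter b p then 1 else 0) := by
    intro p
    rw [← smul_sub, norm_smul, Real.norm_eq_abs, abs_neg]
    by_cases hL : IsLetter b p
    · rw [if_pos hL, mul_one]
      exact mul_le_mul_of_nonneg_left (norm_plaqDatum_sub_le_of_staple hδ0 hδ p) (abs_nonneg _)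
    · rw [if_neg hL, mul_zero, plaqDatum_of_not_isLetter hL, plaqDatum_of_not_isLetter hL, sub_zero, norm_zero,
        mul_zero]
  refine (Finset.sum_le_sum fun p _ => h p).trans (le_of_eq ?_)
  rw [← Finset.mul_sum, Finset.sum_boole, letterCount]
  ring

end Loc

/-! ## §5  THE NUMERIC WILSON SMALL-FIELD COROLLARY -/

section Plug

/-- The one-link gnomonic chart has `n = 3` coordinates. [folklore] -/
theorem card_fibre_eq {b : PBond P j} {n : ℕ} (e : ↥({b} : Finset (PBond P j)) × Fin 3 ≃ Fin n) : n = 3 := by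
  have h := Fintype.card_congr e
  simp only [Fintype.card_prod, Fintype.card_coe, Finset.card_singleton, Fintype.card_fin] at h
  omega

variable [DecidableEq (PBond P j)] {b : PBond P j} {n : ℕ} {u₀ : GaugeField P j SU2} {S : ℝ}

open T4CovarianceResponse (respDom)

/-- **THE NUMERIC WILSON SMALL-FIELD COROLLARY.**  `T4GnomonicWilsonHessian.mem_respDom_of_gnoChart_linkAffine'`
for the Gibbs exponent `h = fun U => −β * wilsonAction w U` through the one-link fibre `{b}` with EVERY action binder
reduced to scalars and NO modulus binder left: `0 ≤ β`, `0 ≤ w`, `0 ≤ ε ≤ 1/8`, `reTr ≥ 1 − ε` on the plaquettes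
through `b` of `u₀` and of `u with u(b) := u₀ b`, staple δ-closeness of `u` to `u₀` (`0 ≤ δ`), `0 ≤ ρ ≤ 1/4`,
`n·S'² ≤ ρ²`, the budget `β·w·2(d−1)·3δ·(1+ρ+ρ²) ≤ bH·dev u`; the convexity modulus in the conclusion is the explicit
`gnoKappa S' + 7/25·(β·w·2(d−1))` (`≥ 960/289`, `gnoKappa_window_ge`).  The measurability / integrability / insert
binders are the plug's, verbatim. [folklore] -/
theorem mem_respDom_of_wilson_smallField_num {ι : Type*} (e : ↥({b} : Finset (PBond P j)) × Fin 3 ≃ Fin n)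
    (hS : 0 < S) {S' : ℝ} (hSS' : S < S') (hS'1 : S' ≤ 1) {β w : ℝ} (hβ : 0 ≤ β) (hw : 0 ≤ w)
    (hhm : Measurable fun U : GaugeField P j SU2 => -β * wilsonAction w U) {C : ℝ}
    (hC : ∀ U, windowDensity {b} u₀ S U * Real.exp (-β * wilsonAction w U) ≤ C) {u : GaugeField P j SU2} {K : ℝ}
    (hK : ∀ y : ↥({b} : Finset (PBond P j)) → SU2,
      |(-β * wilsonAction w (updateFinset u₀ {b} y)) - (-β * wilsonAction w (updateFinset u {b} y))| ≤ K)
    {dev : GaugeField P j SU2 → ℝ} (hdev : 0 ≤ dev u) {ε : ℝ} (hε0 : 0 ≤ ε) (hε8 : ε ≤ 1 / 8)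
    (hsf₀ : ∀ p, IsLetter b p → 1 - ε ≤ reTr (GaugeField.plaqHol u₀ p))
    (hsf₁ : ∀ p, IsLetter b p → 1 - ε ≤ reTr (GaugeField.plaqHol (Function.update u b (u₀ b)) p))
    {δ : ℝ} (hδ0 : 0 ≤ δ) (hδ : ∀ b', IsStaple b b' → ‖su2Quat (u b') - su2Quat (u₀ b')‖ ≤ δ)
    {ρ : ℝ} (hρ : 0 ≤ ρ) (hρ4 : ρ ≤ 1 / 4) (hnS : (n : ℝ) * S' ^ 2 ≤ ρ ^ 2) {bH : ℝ}
    (hgapN : β * w * (2 * ((P.d : ℝ) - 1)) * (3 * δ) * (1 + ρ + ρ ^ 2) ≤ bH * dev u)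
    {B : (↥({b} : Finset (PBond P j)) → SU2) → ι → ℝ} {T : Finset ι} (hBm : ∀ i ∈ T, Measurable fun y => B y i)
    {L : ℝ}
    (hBg : ∀ i ∈ T, ∃ g : (Fin n → ℝ) → ℝ, ContDiff ℝ 1 g ∧
      (∀ x ∈ cube n S, g x = B (gnoFibreChart {b} u₀ e x) i) ∧
      ∀ x ∈ cube n S, coordGradient g x ⬝ᵥ coordGradient g x ≤ L ^ 2) :
    u ∈ respDom {b} (windowDensity {b} u₀ S) (fun U => -β * wilsonAction w U) u₀ B T dev
      (bH / Real.sqrt (gnoKappa S' + 7 / 25 * (β * w * (2 * ((P.d : ℝ) - 1)))))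
      (L / Real.sqrt (gnoKappa S' + 7 / 25 * (β * w * (2 * ((P.d : ℝ) - 1))))) := by
  have hn : n = 3 := card_fibre_eq e
  have hβw : 0 ≤ β * w := mul_nonneg hβ hw
  have hd1 : (1 : ℝ) ≤ (P.d : ℝ) := by exact_mod_cast P.hd
  have hM : 0 ≤ β * w * (2 * ((P.d : ℝ) - 1)) := mul_nonneg hβw (by linarith)
  have hε1 : ε ≤ 1 := by linarith
  have hρ2 : 2 * ρ ^ 2 ≤ 1 := by nlinarith
  have hNc := letterCount_cast b
  -- the aligned parts
  have hA₀' : β * w * ((letterCount b : ℝ) * (1 - ε)) ≤ (wilsonDatum (-β) w u₀ b * su2Quat (u₀ b)).re :=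
    wilson_aligned_ge hβw (g := u₀ b) (by rw [Function.update_eq_self]; exact hsf₀)
  have hA₁' : β * w * ((letterCount b : ℝ) * (1 - ε)) ≤ (wilsonDatum (-β) w u b * su2Quat (u₀ b)).re :=
    wilson_aligned_ge hβw hsf₁
  have hA0 : 0 ≤ β * w * ((letterCount b : ℝ) * (1 - ε)) :=
    mul_nonneg hβw (mul_nonneg (Nat.cast_nonneg _) (by linarith))
  -- the transverse parts
  have hB₀ := wilson_transverse_le hβw hε0 hε1 (g := u₀ b) (u := u₀) (b := b)
    (by rw [Function.update_eq_self]; exact hsf₀)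
  have hB₁ := wilson_transverse_le hβw hε0 hε1 hsf₁
  have hb₀ : 0 ≤ β * w * (letterCount b : ℝ) * Real.sqrt (2 * ε) :=
    mul_nonneg (mul_nonneg hβw (Nat.cast_nonneg _)) (Real.sqrt_nonneg _)
  -- the numeric modulus
  have hmuM := gnoMu_smallField_ge (M := β * w * (2 * ((P.d : ℝ) - 1))) hM hε8 hρ hρ4
  have e1 : β * w * (2 * ((P.d : ℝ) - 1)) * (1 - ε) = β * w * ((letterCount b : ℝ) * (1 - ε)) := by
    rw [hNc]; ring
  have e2 : β * w * (2 * ((P.d : ℝ) - 1)) * Real.sqrt (2 * ε) = β * w * (letterCount b : ℝ) * Real.sqrt (2 * ε) := by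
    rw [hNc]
  rw [e1, e2] at hmuM
  have hmu₀ := hmuM.trans (gnoMu_mono_left hA₀' hρ2)
  have hmu₁ := hmuM.trans (gnoMu_mono_left hA₁' hρ2)
  -- the window floor makes the modulus positive
  have h3S : 3 * S' ^ 2 ≤ 1 / 16 := by
    have h := hnS
    rw [show (n : ℝ) = 3 by exact_mod_cast hn] at h
    nlinarith
  have hlam : 0 < gnoKappa S' + 7 / 25 * (β * w * (2 * ((P.d : ℝ) - 1))) := by
    have hk := gnoKappa_window_ge h3S
    have h0 : 0 ≤ 7 / 25 * (β * w * (2 * ((P.d : ℝ) - 1))) := mul_nonneg (by norm_num) hM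
    linarith
  -- the localised datum gap
  have hgap : ‖wilsonDatum (-β) w u b - wilsonDatum (-β) w u₀ b‖ * (1 + ρ + ρ ^ 2) ≤ bH * dev u := by
    have h := norm_wilsonDatum_sub_le_of_staple (-β) w hδ0 hδ
    rw [show |(-β) * w| = β * w by rw [neg_mul, abs_neg, abs_of_nonneg hβw], hNc] at h
    exact (mul_le_mul_of_nonneg_right h (by positivity)).trans hgapN
  exact mem_respDom_of_gnoChart_linkAffine' e hS hSS' hS'1 hhm hC hK hdev (linkAffine_wilsonAction (-β) w u₀ b)
    (linkAffine_wilsonAction (-β) w u b) (hA0.trans hA₀') (hA0.trans hA₁') hb₀ hB₀ hB₁ hρ hρ2 hnS hmu₀ hmu₁ hlam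
    hgap hBm hBg

/-- NON-VACUITY of the numeric side: with `β·w·2(d−1) = 1`, `ε = 1/8`, `ρ = 1/4` the floor reads
`7/25 ≤ gnoMu (7/8) (1/2) (1/4)` and the window floor `960/289 ≤ gnoKappa S'` needs only `3S'² ≤ 1/16`. [folklore] -/
example : (7 : ℝ) / 25 * 1 ≤ gnoMu (1 * (1 - 1 / 8)) (1 * Real.sqrt (2 * (1 / 8))) (1 / 4) :=
  gnoMu_smallField_ge zero_le_one le_rfl (by norm_num) le_rfl

end Plug

end Literature.MathematicalPhysics.QuantumFieldTheory.Balaban1983to89.T4WilsonSmallFieldNumerics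

end
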